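import Literature.MathematicalPhysics.QuantumFieldTheory.Balaban1983to89.B12Momentum511

/-!
# `Balaban1983to89.B12Rep537Momentum` — T. Bałaban, *Renormalization group approach to lattice gauge field theories. I*,
Commun. Math. Phys. **109** (1987) 249–301 [Balaban1987RG1]: the representation (5.16)/(5.37)/(5.38) p. 293/297 of the vacuum
polarization tensor IN THE PRINTED MOMENTUM FORM `Π̃_{μν}(ζ) = β(δ_{μν}Δ(ζ) − ∂_μ(−ζ)∂_ν(ζ)) + Σ∂̄∂̄∂̄·Π̃′(ζ)`, with «the
coefficients Π′ can be extended to analytic functions of ζ = p + iq on the polystrip ×_μ{|q_μ| < δ₁}» — PROVED from the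
coefficient-side theorem `B12Rep537.rep538` through the (5.11) dictionary of `B12Momentum511`

statement-level skeleton of published theorems with citation tags; proofs where landed; nothing here is a claim about the Yang–Mills mass gap

PDF held: `paper:balaban1987-cmp109-rg-i-small-field` (journal page = PDF page + 248; p. 293 [PDF 45] and p. 297 [PDF 49] read as images
from the page renders `b2b-balaban-ref1/pages/1987-cmp109-rg-I-small-field/…-p045-x2.png`, `…-p049-x2.png`).

CITATION HEADER / WHAT IS REPRODUCED.  SKELETON rows `B12.Eq5.16` (`typed-existing`, «+ proved (moment form)») and
`B12.Eq5.37-5.38` (`proved-existing`, «(moment form: Π − β·WilsonQ has vanishing moments to order 2; remainder controlled by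
(5.10))») of the cell `lit-balaban` (HOME `run/shared/lean/pub/lit-balaban/`, reader file `lit-balaban-r09/ROWS-B12.md`): the
tree proves (5.37)/(5.38) on the COEFFICIENT side (`B12Rep537.rep538`: `Π(x) − βQ_{μν}(x) = Σ_{(κ,λ,ρ)}(Δ*_κΔ*_λΔ*_ρΠ′_{κλρ})(x)`
with `|Π′_{κλρ}(x)| ≤ K³(M + |β|MQ)e^{−δ₁|x|₁}`) and as Laurent series on closed poly-annuli (`B12Rep537.rep537_genFun`);
this file transports both to the printed function `Π̃_{μν}(ζ)` of (5.11) (`B12Momentum511.piT`) and adds what the print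
says about the momentum-space objects: the analyticity of the coefficient functions `Π̃′` on the open polystrip, and the
reading of (5.16) «+ (terms of higher orders in derivatives ∂(p), ∂̄(p))»: `Π̃ − βQ̃` vanishes at `p = 0` together with its
first and second partial derivatives.  Unit `lit-balaban-r09` gen 5.

WHAT IS PRINTED (verbatim; the print writes the momentum-space functions without a tilde).  p. 293 [PDF 45]: *"where
∂_μ(ζ) = e^{iζ_μ} − 1. We will analyze this function using the above properties only. Our goal is to prove a representation
of the form (4.41), more exactly of the form  Π_{μν}(p) = β(δ_{μν}Δ(p) − \overline{∂_μ(p)}∂_ν(p)) + (terms of higher orders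
in derivatives ∂(p), \overline{∂(p)}), (5.16) and to find the coefficient β."*  p. 297 [PDF 49]: *"Using the relations
(5.17) and substituting z_μ = e^{ip_μ}, we obtain finally  Π_{μν}(p) = β(δ_{μν}Δ(p) − \overline{∂_μ(p)}∂_ν(p)) + Π′_{μν}(p).
(5.37)  The function Π′_{μν}(p) has all the symmetries of the function Π_{μν}(p) and it can be written in the form of a third
order polynomial in the derivatives \overline{∂(p)}, ∂(p),  Π′_{μν}(p) = Σ_{κ,λ,ρ}[Π′_{μν,κλρ}(p)\overline{∂_κ(p)}
\overline{∂_λ(p)}\,\overline{∂_ρ(p)} + Π′_{μν,κ,λρ}(p)∂_κ(p)\overline{∂_λ(p)}\,\overline{∂_ρ(p)} + …]. (5.38)  The coefficients Π′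
can be extended to analytic functions of ζ = p + iq on the polystrip ×_μ{|q_μ| < δ₁}."*  Here `Δ(p) = Σ_κ|∂_κ(p)|²` (the
lattice Laplacian symbol, (1.29)–(1.37) [10] / (4.41)), and for real `p`, `\overline{∂_κ(p)} = ∂_κ(−p) = e^{−ip_κ} − 1`.

WHAT IS PROVED (kernel-checked; any `d`; `Π : ℤ^d → ℂ` with the (5.10)-type bound `ExpBound a M Π`, `a = δ₁ > 0`; `β, μ, ν` with
the second-order Taylor data `B12Rep537.TaylorData3 β μ ν Π` — the output of the symmetry analysis (5.12)–(5.36), displayed as the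
hypothesis exactly as in `B12Rep537`).
* §1 `symbQ μ ν ζ = δ_{μν}Σ_κ∂_κ(−ζ)∂_κ(ζ) − ∂_μ(−ζ)∂_ν(ζ)` and **`piT_wilsonQ`**: it IS the momentum representation (5.11) of
  the leading kernel `B12Rep537.wilsonQ μ ν`, at every `ζ ∈ ℂ^d`; `symbQ_real`: at real `p` it is the printed
  `δ_{μν}Δ(p) − \overline{∂_μ(p)}∂_ν(p)`, `Δ(p) = Σ_κ|∂_κ(p)|²`.
* §2 **`eq537`** — (5.37)+(5.38) on the open polystrip `|q_μ| < a`: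
  `Π̃(ζ) = β·symbQ_{μν}(ζ) + Σ_{(κ,λ,ρ)} ∂_κ(−ζ)∂_λ(−ζ)∂_ρ(−ζ)·Π̃′_{κλρ}(ζ)` with `Π̃′_{κλρ} = piT (B12Rep537.rem538 Π β μ ν (κ,λ,ρ))`
  (only the first monomial type of (5.38) is needed, as in `B12Rep537`); **`analyticOnNhd_coeff538`** — «The coefficients Π′
  can be extended to analytic functions of ζ = p + iq on the polystrip ×_μ{|q_μ| < δ₁}» (PROVED: the coefficient kernels decay
  at the full rate, `B12Rep537.rep538`, so `B12Momentum511.analyticOnNhd_piT` applies); `norm_coeff538_le` (their sup bound on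
  closed sub-polystrips, the input of (5.44)); `latticeKernel_coeff538` (their position kernels are the `Π′_{κλρ}(x)` of
  `rep538`, by the inversion formula of (5.11)).
* §3 **(5.16)** `eq516_order0/1/2`: the remainder `Π̃ − βQ̃_{μν} = (Π − βQ_{μν})~` (a kernel with the (5.10)-type bound `B12Rep537.expBound_sub`) VANISHES AT `p = 0` TOGETHER WITH ALL FIRST AND
  SECOND PARTIAL DERIVATIVES («terms of higher orders in derivatives ∂(p), ∂̄(p)»), from the Taylor data via the
  derivatives-under-the-sum theorems of `B12Momentum511`; `piT_sub_lead` identifies that remainder with `Π̃ − β·symbQ` on the strip.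
* §4 the same for the cell's real kernels with `B12Sec2to5.Decay510` (`eq537_of_decay510`).
No `Prop` placeholder; nothing printed is used as a hypothesis beyond (5.10) and the Taylor data; axioms standard.
-/

namespace Literature.MathematicalPhysics.QuantumFieldTheory.Balaban1983to89.B12Rep537Momentum

noncomputable section

open Complex
open scoped Real
open Literature.MathematicalPhysics.QuantumFieldTheory.GawedzkiKupiainen1985.PeriodicGleason
open Literature.MathematicalPhysics.QuantumFieldTheory.Balaban1983to89.B12Rep537 (wilsonQ TaylorData3 rem538 rep538
  rep537_genFun genFun_wilsonQ wilsonQ_bound expBound_sub MQ monom_pair)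
open Literature.MathematicalPhysics.QuantumFieldTheory.Balaban1983to89.B12Momentum511
open Literature.MathematicalPhysics.QuantumFieldTheory.Balaban1983to89.B4Strip (ofRealVec)
open Literature.MathematicalPhysics.QuantumFieldTheory.Balaban1983to89.B4ContourShift (latticeKernel)

variable {d : ℕ}

/-! ## §1. The symbol of the leading kernel: `δ_{μν}Δ(ζ) − ∂_μ(−ζ)∂_ν(ζ)` -/

/-- The momentum form of the leading term of (5.16)/(5.37): `Q̃_{μν}(ζ) = δ_{μν}Σ_κ ∂_κ(−ζ)∂_κ(ζ) − ∂_μ(−ζ)∂_ν(ζ)` with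
`∂_μ(ζ) = e^{iζ_μ} − 1` (`B12Momentum511.dSym`); at real `ζ = p` this is `δ_{μν}Δ(p) − \overline{∂_μ(p)}∂_ν(p)` (`symbQ_real`).
[cite: Balaban1987RG1, (5.37) p.297] -/
def symbQ (μ ν : Fin d) (ζ : Fin d → ℂ) : ℂ :=
  (if μ = ν then ∑ κ, dSym (-ζ) κ * dSym ζ κ else 0) - dSym (-ζ) μ * dSym ζ ν

/-- Every `ζ ∈ ℂ^d` lies in some closed polystrip (width `Σ_μ|q_μ|`). [cite: Balaban1987RG1, (5.11) p.293] -/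
theorem mem_closedPolyStrip_sum (ζ : Fin d → ℂ) : ζ ∈ ClosedPolyStrip d (∑ μ, |(ζ μ).im|) := fun μ =>
  Finset.single_le_sum (f := fun κ => |(ζ κ).im|) (fun _ _ => abs_nonneg _) (Finset.mem_univ μ)

/-- `∂_κ(−ζ) = e^{−iζ_κ} − 1 = w_κ − 1` at `w = e^{−iζ}`. [cite: Balaban1987RG1, (5.15) p.293] -/
theorem dSym_neg (ζ : Fin d → ℂ) (κ : Fin d) : dSym (-ζ) κ = expNegI ζ κ - 1 := by
  simp [dSym, expNegI]

/-- `∂_κ(ζ) = e^{iζ_κ} − 1 = w_κ⁻¹ − 1` at `w = e^{−iζ}`. [cite: Balaban1987RG1, (5.15) p.293] -/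
theorem dSym_eq_inv (ζ : Fin d → ℂ) (κ : Fin d) : dSym ζ κ = (expNegI ζ κ)⁻¹ - 1 := by
  simp [dSym, expNegI, Complex.exp_neg]

/-- **The leading kernel's momentum representation**: `(Q_{μν})~(ζ) = δ_{μν}Σ_κ∂_κ(−ζ)∂_κ(ζ) − ∂_μ(−ζ)∂_ν(ζ)` at EVERY
`ζ ∈ ℂ^d` (the kernel `B12Rep537.wilsonQ μ ν` is finitely supported; its Laurent series is `B12Rep537.genFun_wilsonQ`).
[cite: Balaban1987RG1, (5.37) p.297] -/
theorem piT_wilsonQ (μ ν : Fin d) (ζ : Fin d → ℂ) : piT (wilsonQ μ ν) ζ = symbQ μ ν ζ := by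
  have hw : expNegI ζ ∈ PolyAnnulus d (∑ μ, |(ζ μ).im|) := expNegI_mem_polyAnnulus (mem_closedPolyStrip_sum ζ)
  rw [piT_eq_genFun, genFun_wilsonQ hw μ ν, symbQ]
  simp only [dSym_neg]
  simp only [dSym_eq_inv]

/-- For REAL momenta `p`: `∂_κ(−p) = \overline{∂_κ(p)}`. [cite: Balaban1987RG1, (5.16) p.293] -/
theorem dSym_neg_real (p : Fin d → ℝ) (κ : Fin d) :
    dSym (-ofRealVec p) κ = starRingEnd ℂ (dSym (ofRealVec p) κ) := by
  simp only [dSym, ofRealVec, Pi.neg_apply, map_sub, map_one, ← Complex.exp_conj, map_mul, Complex.conj_I,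
    Complex.conj_ofReal]
  ring_nf

/-- **At real momenta the leading symbol is the printed `δ_{μν}Δ(p) − \overline{∂_μ(p)}∂_ν(p)`**, `Δ(p) = Σ_κ|∂_κ(p)|²`.
[cite: Balaban1987RG1, (5.16) p.293] -/
theorem symbQ_real (μ ν : Fin d) (p : Fin d → ℝ) :
    symbQ μ ν (ofRealVec p) =
      (if μ = ν then ((∑ κ, ‖dSym (ofRealVec p) κ‖ ^ 2 : ℝ) : ℂ) else 0)
        - starRingEnd ℂ (dSym (ofRealVec p) μ) * dSym (ofRealVec p) ν := by
  unfold symbQ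
  simp only [dSym_neg_real]
  congr 1
  split_ifs
  · push_cast
    exact Finset.sum_congr rfl fun κ _ => by rw [Complex.conj_mul']
  · rfl

/-! ## §2. (5.37) + (5.38) for `Π̃_{μν}(ζ)`, and the analyticity of the coefficients `Π̃′` -/

/-- **(5.37) + (5.38) in momentum space** — on the open polystrip `|q_μ| < a` (`a = δ₁`):
`Π̃(ζ) = β(δ_{μν}Σ_κ∂_κ(−ζ)∂_κ(ζ) − ∂_μ(−ζ)∂_ν(ζ)) + Σ_{(κ,λ,ρ)} ∂_κ(−ζ)∂_λ(−ζ)∂_ρ(−ζ)·Π̃′_{κλρ}(ζ)`, the coefficient functions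
being the momentum representations (5.11) of the remainder kernels `Π′_{κλρ}` of `B12Rep537.rem538` (a third-order polynomial
in the `\overline{∂(p)}`, first monomial type of (5.38); `∂_κ(−p) = \overline{∂_κ(p)}` at real `p`, `dSym_neg_real`).
[cite: Balaban1987RG1, (5.37)–(5.38) p.297] -/
theorem eq537 {a M : ℝ} (ha : 0 < a) {P : Pt d → ℂ} (hP : ExpBound a M P) {β : ℂ} {μ ν : Fin d}
    (hT : TaylorData3 β μ ν P) {ζ : Fin d → ℂ} (hζ : ζ ∈ PolyStrip d a) :
    piT P ζ = β * symbQ μ ν ζ + ∑ μs : Fin 3 → Fin d, (∏ j, dSym (-ζ) (μs j)) * piT (rem538 P β μ ν μs) ζ := by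
  obtain ⟨b, hba, hζb⟩ := exists_polyStrip_lt hζ
  have hw : expNegI ζ ∈ PolyAnnulus d b := expNegI_mem_polyAnnulus (polyStrip_subset_closed hζb)
  have h := (rep537_genFun ha hP hT hba hw).1
  simp only [piT_eq_genFun, symbQ, dSym_neg]
  simp only [dSym_eq_inv]
  exact h

/-- **«The coefficients Π′ can be extended to analytic functions of ζ = p + iq on the polystrip ×_μ{|q_μ| < δ₁}»** — PROVED:
each coefficient function `Π̃′_{κλρ} = (Π′_{κλρ})~` of `eq537` is analytic on the open polystrip of the FULL width `a = δ₁`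
(the kernels `Π′_{κλρ}` decay at the full rate `δ₁`, `B12Rep537.rep538`, and (5.11)-series of such kernels are analytic there,
`B12Momentum511.analyticOnNhd_piT`). [cite: Balaban1987RG1, (5.38) p.297] -/
theorem analyticOnNhd_coeff538 {a M : ℝ} (ha : 0 < a) {P : Pt d → ℂ} (hP : ExpBound a M P) {β : ℂ} {μ ν : Fin d}
    (hT : TaylorData3 β μ ν P) (μs : Fin 3 → Fin d) :
    AnalyticOnNhd ℂ (piT (rem538 P β μ ν μs)) (PolyStrip d a) :=
  analyticOnNhd_piT ((rep538 ha hP hT).2 μs)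

/-- The coefficient functions are `2π`-periodic in each variable (as `Π̃` itself). [cite: Balaban1987RG1, (5.38) p.297] -/
theorem coeff538_periodic (P : Pt d → ℂ) (β : ℂ) (μ ν : Fin d) (μs : Fin 3 → Fin d) (ζ : Fin d → ℂ) (κ : Fin d) :
    piT (rem538 P β μ ν μs) (ζ + (2 * π : ℂ) • Pi.single κ 1) = piT (rem538 P β μ ν μs) ζ :=
  piT_periodic _ ζ κ

/-- The sup bound of the coefficient functions on the closed sub-polystrip `|q_μ| ≤ b`, `b < a`:
`|Π̃′_{κλρ}(ζ)| ≤ K(a,d)³(M + |β|MQ(a,d))·Z_d(a − b)` (the bound behind (5.44); same constant as `B12Rep537.rep537_genFun`).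
[cite: Balaban1987RG1, (5.38) p.297] -/
theorem norm_coeff538_le {a M b : ℝ} (ha : 0 < a) {P : Pt d → ℂ} (hP : ExpBound a M P) {β : ℂ} {μ ν : Fin d}
    (hT : TaylorData3 β μ ν P) (hab : b < a) (μs : Fin 3 → Fin d) {ζ : Fin d → ℂ} (hζ : ζ ∈ ClosedPolyStrip d b) :
    ‖piT (rem538 P β μ ν μs) ζ‖ ≤ K a d ^ 3 * (M + ‖β‖ * MQ a d) * Zd (a - b) d :=
  norm_piT_le ((rep538 ha hP hT).2 μs) hab hζ

/-- The position kernels of the coefficient functions are the `Π′_{κλρ}(x)` of `B12Rep537.rep538` — the exponentially decaying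
kernels of (5.44) — by the inversion formula (5.11). [cite: Balaban1987RG1, (5.38) p.297] -/
theorem latticeKernel_coeff538 {a M : ℝ} (ha : 0 < a) {P : Pt d → ℂ} (hP : ExpBound a M P) {β : ℂ} {μ ν : Fin d}
    (hT : TaylorData3 β μ ν P) (μs : Fin 3 → Fin d) (x : Pt d) :
    latticeKernel (piT (rem538 P β μ ν μs)) x = rem538 P β μ ν μs x :=
  latticeKernel_piT ha ((rep538 ha hP hT).2 μs) x

/-! ## §3. (5.16): `Π̃ − βQ̃_{μν}` = «terms of higher orders in derivatives ∂(p), ∂̄(p)» — it vanishes to second order at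
`p = 0` -/

/-- On the open polystrip the remainder of (5.37) is the momentum representation of the remainder kernel:
`Π̃(ζ) − β·Q̃_{μν}(ζ) = (Π − βQ_{μν})~(ζ)`. [cite: Balaban1987RG1, (5.37) p.297] -/
theorem piT_sub_lead {a M : ℝ} (ha : 0 < a) {P : Pt d → ℂ} (hP : ExpBound a M P) (β : ℂ) (μ ν : Fin d)
    {ζ : Fin d → ℂ} (hζ : ζ ∈ PolyStrip d a) :
    piT (P - β • wilsonQ μ ν) ζ = piT P ζ - β * symbQ μ ν ζ := by
  obtain ⟨b, hba, hζb⟩ := exists_polyStrip_lt hζ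
  have hζc : ζ ∈ ClosedPolyStrip d b := polyStrip_subset_closed hζb
  have hsP := summable_piT hP hba hζc
  have hsQ := summable_piT (wilsonQ_bound ha μ ν) hba hζc
  rw [← piT_wilsonQ]
  unfold piT
  rw [← tsum_mul_left, ← hsP.tsum_sub (hsQ.mul_left β)]
  exact tsum_congr fun x => by simp only [Pi.sub_apply, Pi.smul_apply, smul_eq_mul]; ring

/-- The multi-index `e_κ` has degree `1 < 3`. [folklore] -/
private theorem deg_ind_lt (κ : Fin d) : deg (B12Transverse536.ind κ) < 3 := by
  simp only [deg, B12Transverse536.ind, Finset.sum_ite_eq', Finset.mem_univ, if_true]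
  norm_num

/-- The multi-index `e_κ + e_λ` has degree `2 < 3`. [folklore] -/
private theorem deg_pair_lt (κ τ : Fin d) :
    deg (fun j : Fin d => (if j = κ then 1 else 0) + (if j = τ then 1 else 0)) < 3 := by
  simp only [deg, Finset.sum_add_distrib, Finset.sum_ite_eq', Finset.mem_univ, if_true]
  norm_num

/-- The Taylor data at one multi-index, as a vanishing moment of the remainder kernel. [cite: Balaban1987RG1, (5.37) p.297] -/
theorem tsum_remainder_monom {a M : ℝ} (ha : 0 < a) {P : Pt d → ℂ} (hP : ExpBound a M P) {β : ℂ} {μ ν : Fin d}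
    (hT : TaylorData3 β μ ν P) {γ : Fin d → ℕ} (hγ : deg γ < 3) :
    ∑' x, (P - β • wilsonQ μ ν) x * monom γ x = 0 := by
  have h1 : Summable fun x => P x * monom γ x :=
    hP.summable_mul ha (norm_monom_le γ (fun j => le_deg γ j))
  have h2 : Summable fun x => wilsonQ μ ν x * monom γ x :=
    (wilsonQ_bound ha μ ν).summable_mul ha (norm_monom_le γ (fun j => le_deg γ j))
  calc ∑' x, (P - β • wilsonQ μ ν) x * monom γ x
      = ∑' x, (P x * monom γ x - β * (wilsonQ μ ν x * monom γ x)) :=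
        tsum_congr fun x => by simp only [Pi.sub_apply, Pi.smul_apply, smul_eq_mul]; ring
    _ = ∑' x, P x * monom γ x - β * ∑' x, wilsonQ μ ν x * monom γ x := by
        rw [h1.tsum_sub (h2.mul_left β), tsum_mul_left]
    _ = 0 := by rw [hT γ hγ, sub_self]

/-- **(5.16), order 0**: `(Π̃ − βQ̃_{μν})(0) = 0`. [cite: Balaban1987RG1, (5.16) p.293] -/
theorem eq516_order0 {a M : ℝ} (ha : 0 < a) {P : Pt d → ℂ} (hP : ExpBound a M P) {β : ℂ} {μ ν : Fin d}
    (hT : TaylorData3 β μ ν P) : piT (P - β • wilsonQ μ ν) 0 = 0 := by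
  rw [piT_zero]
  have h := tsum_remainder_monom ha hP hT (γ := 0) (by simp [deg])
  simpa [monom] using h

/-- **(5.16), order 1**: `∂/∂p_κ (Π̃ − βQ̃_{μν})(0) = 0` for every `κ`. [cite: Balaban1987RG1, (5.16) p.293] -/
theorem eq516_order1 {a M : ℝ} (ha : 0 < a) {P : Pt d → ℂ} (hP : ExpBound a M P) {β : ℂ} {μ ν : Fin d}
    (hT : TaylorData3 β μ ν P) (κ : Fin d) : pderiv κ (piT (P - β • wilsonQ μ ν)) 0 = 0 := by
  rw [pderiv_piT_zero ha (expBound_sub ha hP β μ ν) κ]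
  have h := tsum_remainder_monom ha hP hT (deg_ind_lt κ)
  simp_rw [B12Transverse536.monom_ind] at h
  rw [show (∑' x : Pt d, (x κ : ℂ) * (P - β • wilsonQ μ ν) x) = 0 from by
    rw [← h]; exact tsum_congr fun x => mul_comm _ _]
  rw [mul_zero]

/-- **(5.16), order 2**: `∂²/∂p_κ∂p_λ (Π̃ − βQ̃_{μν})(0) = 0` for all `κ, λ` — with orders 0 and 1: the remainder of (5.16)/(5.37)
consists of «terms of higher orders in derivatives ∂(p), ∂̄(p)» (it vanishes to second order at `p = 0`; it is analytic on the
polystrip by `B12Momentum511.analyticOnNhd_piT`). [cite: Balaban1987RG1, (5.16) p.293] -/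
theorem eq516_order2 {a M : ℝ} (ha : 0 < a) {P : Pt d → ℂ} (hP : ExpBound a M P) {β : ℂ} {μ ν : Fin d}
    (hT : TaylorData3 β μ ν P) (κ τ : Fin d) : pderiv κ (pderiv τ (piT (P - β • wilsonQ μ ν))) 0 = 0 := by
  have h2 := neg_pderiv_pderiv_piT_zero ha (expBound_sub ha hP β μ ν) κ τ
  have h := tsum_remainder_monom ha hP hT (deg_pair_lt κ τ)
  simp_rw [monom_pair] at h
  rw [h, neg_eq_zero] at h2
  exact h2

/-- The remainder is analytic on the open polystrip of width `a = δ₁`. [cite: Balaban1987RG1, (5.16) p.293] -/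
theorem analyticOnNhd_remainder {a M : ℝ} (ha : 0 < a) {P : Pt d → ℂ} (hP : ExpBound a M P) (β : ℂ) (μ ν : Fin d) :
    AnalyticOnNhd ℂ (piT (P - β • wilsonQ μ ν)) (PolyStrip d a) :=
  analyticOnNhd_piT (expBound_sub ha hP β μ ν)

/-! ## §4. The cell's real kernels ((5.10) typed as `B12Sec2to5.Decay510`) -/

/-- **(5.37)/(5.38) in momentum space for the cell's typed (5.10)**: for a real kernel with `B12Sec2to5.Decay510 Π C δ₁`,
`δ₁ > 0`, and Taylor data `β × Q_{μν}`'s, on the open polystrip `|q_μ| < δ₁`: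
`Π̃(ζ) = β·Q̃_{μν}(ζ) + Σ_{(κ,λ,ρ)}∂_κ(−ζ)∂_λ(−ζ)∂_ρ(−ζ)·Π̃′_{κλρ}(ζ)`, each `Π̃′_{κλρ}` analytic there.
[cite: Balaban1987RG1, (5.37)–(5.38) p.297] -/
theorem eq537_of_decay510 {P : Pt d → ℝ} {C δ₁ : ℝ} {β : ℂ} {μ ν : Fin d} (hδ : 0 < δ₁)
    (h510 : B12Sec2to5.Decay510 P C δ₁) (hT : TaylorData3 β μ ν (B12Rep537.ofReal P)) {ζ : Fin d → ℂ}
    (hζ : ζ ∈ PolyStrip d δ₁) :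
    piT (B12Rep537.ofReal P) ζ = β * symbQ μ ν ζ
        + ∑ μs : Fin 3 → Fin d, (∏ j, dSym (-ζ) (μs j)) * piT (rem538 (B12Rep537.ofReal P) β μ ν μs) ζ ∧
      ∀ μs : Fin 3 → Fin d, AnalyticOnNhd ℂ (piT (rem538 (B12Rep537.ofReal P) β μ ν μs)) (PolyStrip d δ₁) :=
  ⟨eq537 hδ (B12Rep537.expBound_of_decay510 h510) hT hζ,
    fun μs => analyticOnNhd_coeff538 hδ (B12Rep537.expBound_of_decay510 h510) hT μs⟩

end

end Literature.MathematicalPhysics.QuantumFieldTheory.Balaban1983to89.B12Rep537Momentum
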